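import Summits.QuantumFields.BalabanUV.Gaps.D1WardTraceForm
import Summits.QuantumFields.BalabanUV.Gaps.D1ReynoldsMeanDrift
import Summits.QuantumFields.BalabanUV.Beta.D1BFx.RoadEnd

/-!
# `BalabanUV.Gaps.D1WardPSDSandwich` — cell pub-balaban-gaps, row (D1), seat g1-p1: UNDER THE WARD BINDER AND THE PSD BINDER EVERY (1.22) COEFFICIENT IS SANDWICHED,
# `0 ≤ β⁰_j(μ,ν) ≤ −¼ Σ_z tr T_j(z)|z|²`; PSD has BY-VALUE NECESSARY FACES (every diagonal longitudinal moment and the trace moment are `≤ 0`); (D1) then forces `0 ≤ stepBal`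
# pin-free, and the trace drift law alone CAPS every channel's partial sums

HONEST FRAMING (cell rule, page 1 of everything): [folklore] composition BY NAME — the β sub-cell's `PolarizationSign.diag_second_moment_nonpos` (Bochner on boxes) and Lemma 5.2 sign
(row 86's hR-free form `D1WardLongitudinalForm.secondMoment_nonneg_of_ward_indexSymmetric_convPSD`), row 88's trace form (`D1WardTraceForm.sum_offDiag_secondMoment_eq_trace`), GEN 14's
pair bookkeeping (`D1ReynoldsMeanPairs.sum_pairs_secondMoment_eq_two_mul`, `D1ReynoldsMeanDrift.sum_ite_lt_eq_sum_offDiagPairsLT`), road BF-x's `RoadEnd.tendsto_cesaro_of_oneLoopDrift`,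
an2∕an4's `OneStepKernelFamily.D1Drift`.  The Ward binder `hW` (5.9) [Balaban1987RG1 p. 293] and the PSD binder `ConvPSD` (hypothesis (ii) of the β sub-cell's Lemma 5.2 — NOT printed for
Bałaban's Π; `LogDetVariation` signs PIECES only) REMAIN HYPOTHESES on members of the cells' OWN literals; nothing of Bałaban's asserted beyond print; NO coefficient computed or signed;
(D1) NOT discharged; 0∕4 row-D1 binders at the pinned ∕ (III′) literals; NOT `BetaPertH`, NOT continuum, NOT Clay.
HONEST DEPENDENCY (b2b cell, verbatim): «continuum YM on T⁴ ⇐ BetaPertH ∧ nine spine estimates (0/9 proved); BetaPertH ⇐ (D1) ∧ (D4) ∧ CAP+tail; G-an2-4 gates asym, D1 and NE2/3/4.»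

WHY (census row 92 of `HOME/g1/RESIDUE.md`).  Row 86 gave `0 ≤ β⁰_j(μ,ν)` under hW_j + PSD_j (no hR); rows 88–90 introduced the axis-order-blind trace scalar.  Together: (i) under
hW_j + PSD_j at ONE level, **`0 ≤ β⁰_j(μ,ν) ≤ −¼ Σ_ν Σ_z T_j(ν,ν,z)|z|²`** for every channel (the six nonnegative coefficients share the budget `Σ_{a<b} β⁰_j(a,b) = −¼ Σ_z tr T_j|z|²`);
(ii) PSD — an UNDISCHARGED hypothesis of the sign lane — has cheap BY-VALUE NECESSARY faces a desk can test on any deposited kernel: every diagonal longitudinal moment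
`Σ_z T_j(ν,ν,z) z_μ² ≤ 0` and the trace moment `Σ_z tr T_j(z)|z|² ≤ 0`; (iii) pin-free consequences for the binder: under `∀ j (hW_j ∧ PSD_j)`, (D1) at any channel forces
`0 ≤ stepBal N Lc` (row 86 had this AT THE PIN through the limit; here any `cE₂`, no limit), and the trace drift law ALONE caps every channel: `Σ_{j<k} β⁰_j(μ,ν) ≤ 6·(k·stepBal N Lc + A)`.
WHAT IT IS NOT: nothing is discharged; the words of the row do not move.

CONTENT (all [folklore]; no `def`, 0 sorry): §0 `slope_nonneg_of_oneLoopDrift_of_nonneg`; §1 GENERIC `P : B12Beta.Kernel d` under {`MomentSummable P 3`, `WardTransversal P`, `ConvPSD P`}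
(+ `IndexSymmetric P`, `d = 4` for the sandwich): `trace_normSq_moment_nonpos`, **`secondMoment_le_neg_quarter_trace`**; §2 pinned family at level `j` under hW_j + PSD_j (any `1 ≤ Lc`, root,
colours, `cE₂`, `cB`, `T`): `longitudinalMoment_TbalOf_JsBalAn1_nonpos_of_hW_convPSD`, `traceMoment_TbalOf_JsBalAn1_nonpos_of_hW_convPSD`, **`secondMoment_TbalOf_JsBalAn1_le_trace_of_hW_convPSD`**,
**`stepBal_nonneg_of_d1Drift_JsBalAn1_of_hW_convPSD`**, `partialSum_secondMoment_JsBalAn1_le_of_traceDrift_of_hW_convPSD`; §3 the (III′) literal: the same five.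

Provenance: cell pub-balaban-gaps, seat g1-p1 GEN 17 (prover-pub-balaban-gaps-g1-p1-g17-0), 2026-08-25; imports this seat's `Gaps/D1WardTraceForm` (p402435 ✓) + GEN 14's
`Gaps/D1ReynoldsMeanDrift` + road BF-x's `Beta/D1BFx/RoadEnd` (all built); no existing file touched.
-/

noncomputable section

open Filter Topology
open Literature.MathematicalPhysics.QuantumFieldTheory Balaban1983to89 Balaban1983to89.Beta
open OneStepResolventKernel (JetData)
open OneStepKernelFamily (TbalOf flipK D1Drift secondMoment_flipK)
open PolarizationSign (WardTransversal IndexSymmetric MomentSummable ConvPSD secondMoment_comm diag_second_moment_nonpos)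
open Drift (OneLoopDrift)
open AffineAveraging (box)
open Summit.QuantumFields.BalabanUV.Beta.MixedJetTablesPlug (JsBalAn1)
open Summit.QuantumFields.BalabanUV.Beta.CombChartJointEnd (JsB12CombShSym)
open Summit.QuantumFields.BalabanUV.Beta.SymmetrisedStepJets (SymTables)
open Summit.QuantumFields.BalabanUV.Beta.D1BFx.WardDiagonalSecondMoment (momentSummable_mul_pow)
open Summit.QuantumFields.BalabanUV.Beta.D1BFx.RoadEnd (tendsto_cesaro_of_oneLoopDrift)
open Summit.QuantumFields.BalabanUV.Gaps.D1IndexSymmetryDictionary (momentSummable_flipK_TbalOf)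
open Summit.QuantumFields.BalabanUV.Gaps.D1PinnedIndexSymmetry (indexSymmetric_flipK_TbalOf_JsBalAn1)
open Summit.QuantumFields.BalabanUV.Gaps.D1RecordIndexSymmetry (indexSymmetric_flipK_TbalOf_JsB12CombShSym)
open Summit.QuantumFields.BalabanUV.Gaps.D1ReynoldsMeanPairs (sum_pairs_secondMoment_eq_two_mul)
open Summit.QuantumFields.BalabanUV.Gaps.D1ReynoldsMeanDrift (sum_ite_lt_eq_sum_offDiagPairsLT)
open Summit.QuantumFields.BalabanUV.Gaps.D1WardLongitudinalForm (secondMoment_nonneg_of_ward_indexSymmetric_convPSD tsum_diag_sq_flipK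
  secondMoment_TbalOf_JsBalAn1_nonneg_of_hW_convPSD secondMoment_TbalOf_JsB12CombShSym_nonneg_of_hW_convPSD)
open Summit.QuantumFields.BalabanUV.Gaps.D1WardTraceForm (sum_offDiag_secondMoment_eq_trace tsum_diag_normSq_flipK)

namespace Summit.QuantumFields.BalabanUV.Gaps.D1WardPSDSandwich

/-! ## §0 A drift law of a nonnegative sequence has nonnegative slope -/

/-- [folklore] If `0 ≤ f j` for every `j` and `|Σ_{j<k} f j − b·k| ≤ A` for every `k`, then `0 ≤ b` (the Cesàro means are `≥ 0` and tend to `b`). -/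
theorem slope_nonneg_of_oneLoopDrift_of_nonneg {b A : ℝ} {f : ℕ → ℝ} (h : OneLoopDrift b A f) (hf : ∀ j, 0 ≤ f j) : 0 ≤ b :=
  ge_of_tendsto' (tendsto_cesaro_of_oneLoopDrift h) fun m => div_nonneg (Finset.sum_nonneg fun j _ => hf j) (Nat.cast_nonneg m)

/-! ## §1 Generic kernels: PSD's by-value faces and the sandwich -/

section Generic

variable {d : ℕ}

/-- [folklore] **THE TRACE MOMENT IS `≤ 0` UNDER WARD + PSD**: `Σ_ν Σ_z P_{νν}(z)·|z|² ≤ 0` (summable third moments) — each `Σ_z P_{νν}(z) z_μ² ≤ 0` by the β sub-cell's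
`diag_second_moment_nonpos` (Bochner on boxes + the Ward zeroth moment), the finite sum taken inside the lattice sum. -/
theorem trace_normSq_moment_nonpos {P : B12Beta.Kernel d} (hP : MomentSummable P 3) (hT : WardTransversal P) (hPSD : ConvPSD P) :
    ∑ ν, ∑' z, P ν ν z * ∑ μ, (z μ : ℝ) ^ 2 ≤ 0 := by
  refine Finset.sum_nonpos fun ν _ => ?_
  have e : ∑' z, P ν ν z * ∑ μ, (z μ : ℝ) ^ 2 = ∑ μ, ∑' z, P ν ν z * (z μ : ℝ) ^ 2 := by
    rw [← Summable.tsum_finsetSum (fun μ _ => momentSummable_mul_pow hP ν ν μ (by norm_num))]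
    exact tsum_congr fun z => Finset.mul_sum _ _ _
  rw [e]
  exact Finset.sum_nonpos fun μ _ => diag_second_moment_nonpos hP hT hPSD μ ν

/-- [folklore] **THE SANDWICH** (`d = 4`): under (5.9) + (5.8) + PSD + summable third moments, for `μ ≠ ν`, `secondMoment P μ ν ≤ −¼ Σ_ν Σ_z P_{νν}(z)|z|²` — the six coefficients
`β(a,b)`, `a < b`, are each `≥ 0` (row 86's hR-free Lemma 5.2) and SUM to `−¼ Σ_z tr P(z)|z|²` (row 88 + GEN 14's pair bookkeeping). -/
theorem secondMoment_le_neg_quarter_trace {P : B12Beta.Kernel 4} (hP : MomentSummable P 3) (hT : WardTransversal P) (hS : IndexSymmetric P) (hPSD : ConvPSD P) {μ ν : Fin 4}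
    (hμν : μ ≠ ν) : B12Beta.secondMoment P μ ν ≤ -(1 / 4) * ∑ ν, ∑' z, P ν ν z * ∑ μ, (z μ : ℝ) ^ 2 := by
  have hpairs : ∑ p ∈ (Finset.univ.filter fun p : Fin 4 × Fin 4 => p.1 < p.2), B12Beta.secondMoment P p.1 p.2 = -(1 / 4) * ∑ ν, ∑' z, P ν ν z * ∑ μ, (z μ : ℝ) ^ 2 := by
    have h2 := sum_pairs_secondMoment_eq_two_mul hS
    have htr := sum_offDiag_secondMoment_eq_trace hP hT hS
    rw [← sum_ite_lt_eq_sum_offDiagPairsLT]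
    linarith
  have hnonneg : ∀ p ∈ (Finset.univ.filter fun p : Fin 4 × Fin 4 => p.1 < p.2), 0 ≤ B12Beta.secondMoment P p.1 p.2 :=
    fun p hp => secondMoment_nonneg_of_ward_indexSymmetric_convPSD hP hT hS hPSD (ne_of_lt (Finset.mem_filter.mp hp).2)
  rcases lt_or_gt_of_ne hμν with h | h
  · exact (Finset.single_le_sum hnonneg (Finset.mem_filter.mpr ⟨Finset.mem_univ (μ, ν), h⟩)).trans_eq hpairs
  · rw [secondMoment_comm hS μ ν]
    exact (Finset.single_le_sum hnonneg (Finset.mem_filter.mpr ⟨Finset.mem_univ (ν, μ), h⟩)).trans_eq hpairs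

end Generic

/-! ## §2 The β-lead's pinned family at one level under `hW_j ∧ PSD_j`; pin-free consequences for (D1) -/

section Pinned

variable {Lc : ℕ} [NeZero Lc] {r : Fin (3 + 1) → ℕ}

/-- [folklore] **PSD's BY-VALUE FACE No. 1**: under hW_j + PSD_j EVERY diagonal longitudinal moment of the level-`j` kernel is `≤ 0`: `Σ_z T_j(ν,ν,z) z_μ² ≤ 0` (all `μ, ν`; `= 0` for `μ = ν` by Ward). -/
theorem longitudinalMoment_TbalOf_JsBalAn1_nonpos_of_hW_convPSD (hLc : 1 ≤ Lc) (hr : r ∈ box (3 + 1) Lc) (cE cVH cΛ cE₂ cB : ℝ) (T : Fin 4 → Fin 4 → Fin 4 → Fin 4 → ℝ) (j : ℕ)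
    (hW : WardTransversal (flipK (TbalOf Lc (JsBalAn1 hLc hr cE cVH cΛ cE₂ cB T) j))) (hPSD : ConvPSD (flipK (TbalOf Lc (JsBalAn1 hLc hr cE cVH cΛ cE₂ cB T) j))) (μ ν : Fin 4) :
    ∑' z, TbalOf Lc (JsBalAn1 hLc hr cE cVH cΛ cE₂ cB T) j ν ν z * (z μ : ℝ) ^ 2 ≤ 0 := by
  have h := diag_second_moment_nonpos (momentSummable_flipK_TbalOf _ j 3) hW hPSD μ ν
  rwa [tsum_diag_sq_flipK] at h

/-- [folklore] **PSD's BY-VALUE FACE No. 2**: under hW_j + PSD_j the trace moment of the level-`j` kernel is `≤ 0`: `Σ_ν Σ_z T_j(ν,ν,z)|z|² ≤ 0`. -/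
theorem traceMoment_TbalOf_JsBalAn1_nonpos_of_hW_convPSD (hLc : 1 ≤ Lc) (hr : r ∈ box (3 + 1) Lc) (cE cVH cΛ cE₂ cB : ℝ) (T : Fin 4 → Fin 4 → Fin 4 → Fin 4 → ℝ) (j : ℕ)
    (hW : WardTransversal (flipK (TbalOf Lc (JsBalAn1 hLc hr cE cVH cΛ cE₂ cB T) j))) (hPSD : ConvPSD (flipK (TbalOf Lc (JsBalAn1 hLc hr cE cVH cΛ cE₂ cB T) j))) :
    ∑ ν, ∑' z, TbalOf Lc (JsBalAn1 hLc hr cE cVH cΛ cE₂ cB T) j ν ν z * ∑ μ, (z μ : ℝ) ^ 2 ≤ 0 := by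
  have h := trace_normSq_moment_nonpos (momentSummable_flipK_TbalOf _ j 3) hW hPSD
  simpa only [tsum_diag_normSq_flipK] using h

/-- [folklore] **THE SANDWICH AT LEVEL `j`**: under hW_j + PSD_j, for `μ ≠ ν`, `β⁰_j(μ,ν) ≤ −¼ Σ_ν Σ_z T_j(ν,ν,z)|z|²` (with row 86's `0 ≤ β⁰_j(μ,ν)`: every coefficient lies between `0` and the
axis-order-blind trace scalar `6·t_j`). -/
theorem secondMoment_TbalOf_JsBalAn1_le_trace_of_hW_convPSD (hLc : 1 ≤ Lc) (hr : r ∈ box (3 + 1) Lc) (cE cVH cΛ cE₂ cB : ℝ) (T : Fin 4 → Fin 4 → Fin 4 → Fin 4 → ℝ) (j : ℕ)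
    (hW : WardTransversal (flipK (TbalOf Lc (JsBalAn1 hLc hr cE cVH cΛ cE₂ cB T) j))) (hPSD : ConvPSD (flipK (TbalOf Lc (JsBalAn1 hLc hr cE cVH cΛ cE₂ cB T) j))) {μ ν : Fin 4}
    (hμν : μ ≠ ν) :
    B12Beta.secondMoment (TbalOf Lc (JsBalAn1 hLc hr cE cVH cΛ cE₂ cB T) j) μ ν ≤ -(1 / 4) * ∑ ν, ∑' z, TbalOf Lc (JsBalAn1 hLc hr cE cVH cΛ cE₂ cB T) j ν ν z * ∑ μ, (z μ : ℝ) ^ 2 := by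
  have h := secondMoment_le_neg_quarter_trace (momentSummable_flipK_TbalOf _ j 3) hW (indexSymmetric_flipK_TbalOf_JsBalAn1 hLc hr cE cVH cΛ cE₂ cB T j) hPSD hμν
  rw [secondMoment_flipK] at h
  simpa only [tsum_diag_normSq_flipK] using h

/-- [folklore] **(D1) UNDER `∀ j (hW_j ∧ PSD_j)` FORCES `0 ≤ stepBal N Lc` — PIN-FREE** (any `cE₂`; row 86's `not_d1Drift_of_stepBal_neg_of_hW_convPSD` needed the pin and the limit). -/
theorem stepBal_nonneg_of_d1Drift_JsBalAn1_of_hW_convPSD (hLc : 1 ≤ Lc) (hr : r ∈ box (3 + 1) Lc) (cE cVH cΛ cE₂ cB : ℝ) (T : Fin 4 → Fin 4 → Fin 4 → Fin 4 → ℝ) {μ ν : Fin 4} (hμν : μ ≠ ν)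
    (N : ℝ) (hW : ∀ j : ℕ, WardTransversal (flipK (TbalOf Lc (JsBalAn1 hLc hr cE cVH cΛ cE₂ cB T) j)))
    (hPSD : ∀ j : ℕ, ConvPSD (flipK (TbalOf Lc (JsBalAn1 hLc hr cE cVH cΛ cE₂ cB T) j))) (hD : D1Drift Lc (JsBalAn1 hLc hr cE cVH cΛ cE₂ cB T) N μ ν) :
    0 ≤ B12Normalization.stepBal N Lc := by
  obtain ⟨A, hA⟩ := hD
  exact slope_nonneg_of_oneLoopDrift_of_nonneg hA fun j => secondMoment_TbalOf_JsBalAn1_nonneg_of_hW_convPSD hLc hr cE cVH cΛ cE₂ cB T j (hW j) (hPSD j) hμν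

/-- [folklore] **THE TRACE DRIFT LAW ALONE CAPS EVERY CHANNEL UNDER `∀ j (hW_j ∧ PSD_j)`**: if `|Σ_{j<k} t_j − k·stepBal| ≤ A` for `t_j := −(1∕24) Σ_ν Σ_z T_j(ν,ν,z)|z|²`, then for every
channel `μ ≠ ν` and every `k`, `Σ_{j<k} β⁰_j(μ,ν) ≤ 6·(k·stepBal N Lc + A)`. -/
theorem partialSum_secondMoment_JsBalAn1_le_of_traceDrift_of_hW_convPSD (hLc : 1 ≤ Lc) (hr : r ∈ box (3 + 1) Lc) (cE cVH cΛ cE₂ cB : ℝ) (T : Fin 4 → Fin 4 → Fin 4 → Fin 4 → ℝ)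
    {μ ν : Fin 4} (hμν : μ ≠ ν) (N : ℝ) (hW : ∀ j : ℕ, WardTransversal (flipK (TbalOf Lc (JsBalAn1 hLc hr cE cVH cΛ cE₂ cB T) j)))
    (hPSD : ∀ j : ℕ, ConvPSD (flipK (TbalOf Lc (JsBalAn1 hLc hr cE cVH cΛ cE₂ cB T) j))) {A : ℝ}
    (htr : OneLoopDrift (B12Normalization.stepBal N Lc) A (fun j => -(1 / 24) * ∑ ν, ∑' z, TbalOf Lc (JsBalAn1 hLc hr cE cVH cΛ cE₂ cB T) j ν ν z * ∑ μ, (z μ : ℝ) ^ 2)) (k : ℕ) :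
    ∑ j ∈ Finset.range k, B12Beta.secondMoment (TbalOf Lc (JsBalAn1 hLc hr cE cVH cΛ cE₂ cB T) j) μ ν ≤ 6 * (B12Normalization.stepBal N Lc * k + A) := by
  have h1 := (abs_le.mp (htr k)).2
  have h2 : ∀ j, B12Beta.secondMoment (TbalOf Lc (JsBalAn1 hLc hr cE cVH cΛ cE₂ cB T) j) μ ν ≤
      6 * (-(1 / 24) * ∑ ν, ∑' z, TbalOf Lc (JsBalAn1 hLc hr cE cVH cΛ cE₂ cB T) j ν ν z * ∑ μ, (z μ : ℝ) ^ 2) := fun j => by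
    have := secondMoment_TbalOf_JsBalAn1_le_trace_of_hW_convPSD hLc hr cE cVH cΛ cE₂ cB T j (hW j) (hPSD j) hμν
    linarith
  calc ∑ j ∈ Finset.range k, B12Beta.secondMoment (TbalOf Lc (JsBalAn1 hLc hr cE cVH cΛ cE₂ cB T) j) μ ν
      ≤ ∑ j ∈ Finset.range k, 6 * (-(1 / 24) * ∑ ν, ∑' z, TbalOf Lc (JsBalAn1 hLc hr cE cVH cΛ cE₂ cB T) j ν ν z * ∑ μ, (z μ : ℝ) ^ 2) :=
        Finset.sum_le_sum fun j _ => h2 j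
    _ = 6 * ∑ j ∈ Finset.range k, -(1 / 24) * ∑ ν, ∑' z, TbalOf Lc (JsBalAn1 hLc hr cE cVH cΛ cE₂ cB T) j ν ν z * ∑ μ, (z μ : ℝ) ^ 2 := by rw [Finset.mul_sum]
    _ ≤ 6 * (B12Normalization.stepBal N Lc * k + A) := by linarith

end Pinned

/-! ## §3 The b2b wall's (III′) literal over every table record -/

section Record

variable {Lc : ℕ} [NeZero Lc]

/-- [folklore] **PSD's BY-VALUE FACE No. 1, (III′) LITERAL**: `Σ_z T_j(ν,ν,z) z_μ² ≤ 0` under hW_j + PSD_j. -/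
theorem longitudinalMoment_TbalOf_JsB12CombShSym_nonpos_of_hW_convPSD (hLc : Odd Lc) (N : ℕ) (tabs : SymTables 3 Lc) (cΛ cB : ℝ) (j : ℕ)
    (hW : WardTransversal (flipK (TbalOf Lc (JsB12CombShSym hLc N tabs cΛ cB) j))) (hPSD : ConvPSD (flipK (TbalOf Lc (JsB12CombShSym hLc N tabs cΛ cB) j))) (μ ν : Fin 4) :
    ∑' z, TbalOf Lc (JsB12CombShSym hLc N tabs cΛ cB) j ν ν z * (z μ : ℝ) ^ 2 ≤ 0 := by
  have h := diag_second_moment_nonpos (momentSummable_flipK_TbalOf _ j 3) hW hPSD μ ν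
  rwa [tsum_diag_sq_flipK] at h

/-- [folklore] **PSD's BY-VALUE FACE No. 2, (III′) LITERAL**: `Σ_ν Σ_z T_j(ν,ν,z)|z|² ≤ 0` under hW_j + PSD_j. -/
theorem traceMoment_TbalOf_JsB12CombShSym_nonpos_of_hW_convPSD (hLc : Odd Lc) (N : ℕ) (tabs : SymTables 3 Lc) (cΛ cB : ℝ) (j : ℕ)
    (hW : WardTransversal (flipK (TbalOf Lc (JsB12CombShSym hLc N tabs cΛ cB) j))) (hPSD : ConvPSD (flipK (TbalOf Lc (JsB12CombShSym hLc N tabs cΛ cB) j))) :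
    ∑ ν, ∑' z, TbalOf Lc (JsB12CombShSym hLc N tabs cΛ cB) j ν ν z * ∑ μ, (z μ : ℝ) ^ 2 ≤ 0 := by
  have h := trace_normSq_moment_nonpos (momentSummable_flipK_TbalOf _ j 3) hW hPSD
  simpa only [tsum_diag_normSq_flipK] using h

/-- [folklore] **THE SANDWICH AT LEVEL `j`, (III′) LITERAL**: `β⁰_j(μ,ν) ≤ −¼ Σ_ν Σ_z T_j(ν,ν,z)|z|²` under hW_j + PSD_j (`μ ≠ ν`). -/
theorem secondMoment_TbalOf_JsB12CombShSym_le_trace_of_hW_convPSD (hLc : Odd Lc) (N : ℕ) (tabs : SymTables 3 Lc) (cΛ cB : ℝ) (j : ℕ)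
    (hW : WardTransversal (flipK (TbalOf Lc (JsB12CombShSym hLc N tabs cΛ cB) j))) (hPSD : ConvPSD (flipK (TbalOf Lc (JsB12CombShSym hLc N tabs cΛ cB) j))) {μ ν : Fin 4}
    (hμν : μ ≠ ν) :
    B12Beta.secondMoment (TbalOf Lc (JsB12CombShSym hLc N tabs cΛ cB) j) μ ν ≤ -(1 / 4) * ∑ ν, ∑' z, TbalOf Lc (JsB12CombShSym hLc N tabs cΛ cB) j ν ν z * ∑ μ, (z μ : ℝ) ^ 2 := by
  have h := secondMoment_le_neg_quarter_trace (momentSummable_flipK_TbalOf _ j 3) hW (indexSymmetric_flipK_TbalOf_JsB12CombShSym hLc N tabs cΛ cB j) hPSD hμν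
  rw [secondMoment_flipK] at h
  simpa only [tsum_diag_normSq_flipK] using h

/-- [folklore] **(D1) FOR THE (III′) LITERAL UNDER `∀ j (hW_j ∧ PSD_j)` FORCES `0 ≤ stepBal Nc Lc` — PIN-FREE.** -/
theorem stepBal_nonneg_of_d1Drift_JsB12CombShSym_of_hW_convPSD (hLc : Odd Lc) (N : ℕ) (tabs : SymTables 3 Lc) (cΛ cB : ℝ) {μ ν : Fin 4} (hμν : μ ≠ ν) (Nc : ℝ)
    (hW : ∀ j : ℕ, WardTransversal (flipK (TbalOf Lc (JsB12CombShSym hLc N tabs cΛ cB) j))) (hPSD : ∀ j : ℕ, ConvPSD (flipK (TbalOf Lc (JsB12CombShSym hLc N tabs cΛ cB) j)))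
    (hD : D1Drift Lc (JsB12CombShSym hLc N tabs cΛ cB) Nc μ ν) : 0 ≤ B12Normalization.stepBal Nc Lc := by
  obtain ⟨A, hA⟩ := hD
  exact slope_nonneg_of_oneLoopDrift_of_nonneg hA fun j => secondMoment_TbalOf_JsB12CombShSym_nonneg_of_hW_convPSD hLc N tabs cΛ cB j (hW j) (hPSD j) hμν

/-- [folklore] **THE TRACE DRIFT LAW ALONE CAPS EVERY CHANNEL, (III′) LITERAL**: `Σ_{j<k} β⁰_j(μ,ν) ≤ 6·(k·stepBal Nc Lc + A)` under `∀ j (hW_j ∧ PSD_j)`. -/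
theorem partialSum_secondMoment_JsB12CombShSym_le_of_traceDrift_of_hW_convPSD (hLc : Odd Lc) (N : ℕ) (tabs : SymTables 3 Lc) (cΛ cB : ℝ) {μ ν : Fin 4} (hμν : μ ≠ ν) (Nc : ℝ)
    (hW : ∀ j : ℕ, WardTransversal (flipK (TbalOf Lc (JsB12CombShSym hLc N tabs cΛ cB) j))) (hPSD : ∀ j : ℕ, ConvPSD (flipK (TbalOf Lc (JsB12CombShSym hLc N tabs cΛ cB) j))) {A : ℝ}
    (htr : OneLoopDrift (B12Normalization.stepBal Nc Lc) A (fun j => -(1 / 24) * ∑ ν, ∑' z, TbalOf Lc (JsB12CombShSym hLc N tabs cΛ cB) j ν ν z * ∑ μ, (z μ : ℝ) ^ 2)) (k : ℕ) :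
    ∑ j ∈ Finset.range k, B12Beta.secondMoment (TbalOf Lc (JsB12CombShSym hLc N tabs cΛ cB) j) μ ν ≤ 6 * (B12Normalization.stepBal Nc Lc * k + A) := by
  have h1 := (abs_le.mp (htr k)).2
  have h2 : ∀ j, B12Beta.secondMoment (TbalOf Lc (JsB12CombShSym hLc N tabs cΛ cB) j) μ ν ≤
      6 * (-(1 / 24) * ∑ ν, ∑' z, TbalOf Lc (JsB12CombShSym hLc N tabs cΛ cB) j ν ν z * ∑ μ, (z μ : ℝ) ^ 2) := fun j => by
    have := secondMoment_TbalOf_JsB12CombShSym_le_trace_of_hW_convPSD hLc N tabs cΛ cB j (hW j) (hPSD j) hμν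
    linarith
  calc ∑ j ∈ Finset.range k, B12Beta.secondMoment (TbalOf Lc (JsB12CombShSym hLc N tabs cΛ cB) j) μ ν
      ≤ ∑ j ∈ Finset.range k, 6 * (-(1 / 24) * ∑ ν, ∑' z, TbalOf Lc (JsB12CombShSym hLc N tabs cΛ cB) j ν ν z * ∑ μ, (z μ : ℝ) ^ 2) :=
        Finset.sum_le_sum fun j _ => h2 j
    _ = 6 * ∑ j ∈ Finset.range k, -(1 / 24) * ∑ ν, ∑' z, TbalOf Lc (JsB12CombShSym hLc N tabs cΛ cB) j ν ν z * ∑ μ, (z μ : ℝ) ^ 2 := by rw [Finset.mul_sum]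
    _ ≤ 6 * (B12Normalization.stepBal Nc Lc * k + A) := by linarith

end Record

end Summit.QuantumFields.BalabanUV.Gaps.D1WardPSDSandwich

end
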